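import Summits.AtomisticToContinuum.HydrodynamicLimit.Theorems.CollisionIsometryCLTAdaptedWeightCLTBlockHDissipationB
import Summits.AtomisticToContinuum.HydrodynamicLimit.Theorems.CollisionIsometryCLTAdaptedWeightCLTBHDVAggregateMeasurable
import Summits.AtomisticToContinuum.HydrodynamicLimit.Theorems.CollisionIsometryCLTAdaptedWeightCLTBHDVAggregateEnvelope
import Summits.AtomisticToContinuum.HydrodynamicLimit.Theorems.CollisionIsometryCLTAdaptedWeightCLTBHDVAggregateLogChaos

/-!
# Aggregate DV step (stub `stub_dvAggregate`, G2) for the line `block-h-dissipation-closure`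
# (crux `AdaptedWeightCLT`, stmt-AtomisticToContinuum-14868), file 4: `x`-free majorants and the registered stub

Proof file (`--supports stmt-AtomisticToContinuum-14868`) of the line lead
`prover-line-stmt-AtomisticToContinuum-14868-c4-0` for the registered stub `stub_dvAggregate` (= input G2 of the
Donsker–Varadhan chain, `DVAggregateOn`: `∀ η > 0, P_N{dvActW + η(N+1)^{1/3} < crossEW − relEnt} → 0`).

The S2 worker proved the pointwise DV inequality per good orbit and cell-window and reduced G2 to the
integrability on `𝕋³` of `x ↦ cellOK·crossE`, `x ↦ klTerm`, `x ↦ cellOK·dvAct`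
(`DVTransfer.dvAggregateOn_of_xIntegrable`). Here the three integrands — as functions of (location, quadruple) —
are dominated by integrable functions of the quadruple ALONE (files 2–3: all envelopes are uniform in `x`; the
kernel is bounded, `ψ_N ≤ C′(N+1)^{3γc}`), and are jointly Borel (file 1), so Fubini on the finite measure space
`𝕋³ × Quad` gives the three integrabilities (`xIntegrable`); on the good set, which is conull for `localGibbsLaw`,
the bad events of G2 are then empty for every `N`:

* `exists_majorant_dvAct` — `|½ ΔΛ_x · contactDens_x| ≤ Σ_contacts (a + b Σ_m‖y_m‖²) G_h^{⊗4}(y − c)`;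
* `exists_majorant_kl` — `|contactDens_x log(contactDens_x/(contactMass_x chaosDens_x))| ≤` the same shape
  (junk cell-windows and empty windows contribute `0`);
* `exists_majorant_tilt` — `e^{ΔΛ_x/2} chaosDens_x ≤ C Σ_{l,l′} F̄_l(y₁) F̄_{l′}(y₂) (∫B_{ll′})⁻¹ S_{ll′}(y₃, y₄)`
  (tilted mollifiers dominated by mollifiers of width `2h`; normalised coefficients `≤ (∫B_{ll′})⁻¹`);
* `xIntegrable`, `stub_dvAggregate`.

`TailsOn` and `FewCollisionsOn` are not used: G2 holds with zero slack, deterministically on good orbits.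
No definitions.
-/

namespace Summit.AtomisticToContinuum.HydrodynamicLimit.Theorems.BlockHDissipation

open scoped BigOperators Topology Classical MeasureTheory ENNReal InnerProductSpace
open Filter Set MeasureTheory Real
open Literature.Analysis.FluidPDE
open Summit.AtomisticToContinuum.HydrodynamicLimit.Theorems.ContactSourceDuhamel (T3 V3 Cfg Vel Flow Flows)
open Summit.AtomisticToContinuum.HydrodynamicLimit.Theorems.ContactSourceDuhamel.TimeLocal
open Literature.MathematicalPhysics.KineticTheory (hsDiameter localGibbsLaw collide hardSphereKernel sphereMeasure)

noncomputable section

namespace DVAggregate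

variable {σ : ℝ} {N : ℕ} {ψ : ℕ → T3 → ℝ}

/-! ## Majorants depending on the quadruple only -/

/-- Affine quadratic weights about the origin against a product mollifier are integrable on `Quad`. -/
theorem integrable_qn_mul_gauss4 {h : ℝ} (hh : h ≠ 0) (A B : ℝ) (c : Quad) :
    Integrable fun y : Quad =>
      (A + B * (‖y.1‖ ^ 2 + ‖y.2.1‖ ^ 2 + ‖y.2.2.1‖ ^ 2 + ‖y.2.2.2‖ ^ 2)) * gauss4 h c y := by
  refine (DVTransfer.integrable_quadMoment_mul_gauss4 hh A B (0 : Quad) c).congr (Eventually.of_forall fun y => ?_)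
  simp only [Prod.fst_zero, Prod.snd_zero, sub_zero]

/-- `G_h^{⊗4} ≥ 0`. -/
theorem gauss4_nonneg (h : ℝ) (c y : Quad) : 0 ≤ gauss4 h c y :=
  mul_nonneg (mul_nonneg (mul_nonneg (DVTransfer.gauss_nonneg h _ _) (DVTransfer.gauss_nonneg h _ _))
    (DVTransfer.gauss_nonneg h _ _)) (DVTransfer.gauss_nonneg h _ _)

/-- The smeared contact density against a bounded kernel: `contactDens_x(y) ≤ Σ_contacts A · G_h^{⊗4}(y − c)`. -/
theorem contactDens_le_sum {A : ℝ} (hA : ∀ y, ψ N y ≤ A) (Φ : Flow σ N) (γc h t : ℝ) (z : Cfg N) (k : ℕ) (x : T3)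
    (hfin : (collisionTimes (Torus.geometry (Fin 3)) (hsDiameter σ N) (fun s => Φ.flow s z) ∩ win γc N t k).Finite)
    (y : Quad) :
    contactDens σ N Φ ψ γc h t z k x y ≤ ∑ s ∈ hfin.toFinset,
      ∑ pp ∈ contactPairs (Torus.geometry (Fin 3)) (hsDiameter σ N) (Φ.flow s z),
        A * gauss4 h (quadOf N (Φ.flow s z) pp.1 pp.2) y := by
  rw [DVTransfer.contactDens_eq_sum Φ ψ γc h t z k x hfin y]
  exact Finset.sum_le_sum fun s _ => Finset.sum_le_sum fun pp _ =>
    mul_le_mul_of_nonneg_right (hA _) (gauss4_nonneg h _ y)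

/-- **Majorant of the DV action integrand**: for a nonnegative kernel family bounded by `A`, `0 < h`, `0 < δ ≤ 1`, a
good initial datum, a window `k` and any window-start configuration `w`, there is an integrable `g` on `Quad` with
`|½ ΔΛ_x(y) contactDens_x(y)| ≤ g(y)` for EVERY location `x`. -/
theorem exists_majorant_dvAct (hψ : ∀ N y, 0 ≤ ψ N y) {A : ℝ} (hA : ∀ y, ψ N y ≤ A) {h : ℝ} (hh : 0 < h) {δ : ℝ}
    (hδ0 : 0 < δ) (hδ1 : δ ≤ 1) (Φ : Flow σ N) (γc t : ℝ) {z : Cfg N} (hz : z ∈ Φ.good) (k : ℕ) (w : Cfg N) :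
    ∃ g : Quad → ℝ, Integrable g ∧ ∀ (x : T3) (y : Quad),
      ‖2⁻¹ * dLam N ψ h δ w x y * contactDens σ N Φ ψ γc h t z k x y‖ ≤ g y := by
  have hfin := DVTransfer.finite_collisionTimes_win Φ hz γc t k
  obtain ⟨Λ, hΛ0, hΛ⟩ := exists_abs_dLam_le hψ hh hδ0 hδ1 w (norm_vel_le_sum w)
  have hA0 : 0 ≤ A := (hψ N 0).trans (hA 0)
  refine ⟨fun y => ∑ s ∈ hfin.toFinset, ∑ pp ∈ contactPairs (Torus.geometry (Fin 3)) (hsDiameter σ N) (Φ.flow s z),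
      (2⁻¹ * A * Λ + 2⁻¹ * A * (h ^ 2)⁻¹ * (‖y.1‖ ^ 2 + ‖y.2.1‖ ^ 2 + ‖y.2.2.1‖ ^ 2 + ‖y.2.2.2‖ ^ 2)) *
        gauss4 h (quadOf N (Φ.flow s z) pp.1 pp.2) y, ?_, fun x y => ?_⟩
  · exact integrable_finsetSum _ fun s _ => integrable_finsetSum _ fun pp _ => integrable_qn_mul_gauss4 hh.ne' _ _ _
  · have hd := hΛ x y
    have hp0 : 0 ≤ contactDens σ N Φ ψ γc h t z k x y := DVTransfer.contactDens_nonneg hψ Φ γc hh.ne' t z k x hfin y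
    have hpA := contactDens_le_sum hA Φ γc h t z k x hfin y
    set qn : ℝ := ‖y.1‖ ^ 2 + ‖y.2.1‖ ^ 2 + ‖y.2.2.1‖ ^ 2 + ‖y.2.2.2‖ ^ 2 with hqn
    have hC0 : 0 ≤ 2⁻¹ * (Λ + qn / h ^ 2) := by positivity
    rw [Real.norm_eq_abs, abs_mul, abs_of_nonneg hp0, abs_mul, abs_of_pos (by norm_num : (0 : ℝ) < 2⁻¹)]
    calc 2⁻¹ * |dLam N ψ h δ w x y| * contactDens σ N Φ ψ γc h t z k x y
        ≤ 2⁻¹ * (Λ + qn / h ^ 2) * ∑ s ∈ hfin.toFinset,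
            ∑ pp ∈ contactPairs (Torus.geometry (Fin 3)) (hsDiameter σ N) (Φ.flow s z),
              A * gauss4 h (quadOf N (Φ.flow s z) pp.1 pp.2) y :=
          mul_le_mul (mul_le_mul_of_nonneg_left hd (by norm_num)) hpA hp0 hC0
      _ = _ := by
          rw [Finset.mul_sum]
          refine Finset.sum_congr rfl fun s _ => ?_
          rw [Finset.mul_sum]
          refine Finset.sum_congr rfl fun pp _ => ?_
          rw [div_eq_mul_inv]
          ring

/-- **Majorant of the relative-entropy integrand**: for a nonnegative kernel family bounded by `A`, `0 < h`, a good
initial datum, a window `k` and any reference configuration `w`, there is an integrable `g` on `Quad` with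
`|contactDens_x log(contactDens_x/(contactMass_x · chaosDens_x))| ≤ g` for EVERY location `x` (junk cell-windows
`pairZ = 0` and empty windows `contactMass_x = 0` contribute `0` by the conventions `x/0 = 0`, `log 0 = 0`). -/
theorem exists_majorant_kl (hψ : ∀ N y, 0 ≤ ψ N y) {A : ℝ} (hA : ∀ y, ψ N y ≤ A) {h : ℝ} (hh : 0 < h)
    (Φ : Flow σ N) (γc t : ℝ) {z : Cfg N} (hz : z ∈ Φ.good) (k : ℕ) (w : Cfg N) :
    ∃ g : Quad → ℝ, Integrable g ∧ ∀ (x : T3) (y : Quad),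
      ‖contactDens σ N Φ ψ γc h t z k x y * Real.log (contactDens σ N Φ ψ γc h t z k x y /
        (contactMass σ N Φ ψ γc t z k x * chaosDens N ψ h w x y))‖ ≤ g y := by
  have hfin := DVTransfer.finite_collisionTimes_win Φ hz γc t k
  have hV := norm_vel_le_sum w
  obtain ⟨M, hM0, hM⟩ := exists_abs_log_contactDens_sub_le (h := h) hψ hh.ne' Φ γc t hz k
  obtain ⟨L, hL⟩ : ∃ L : ℝ, L = 2 * Real.log ((N + 1 : ℕ) : ℝ) + 8 * |Real.log (gauss h (0 : V3) 0)| +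
      6 * (∑ j, ‖(w j).2‖) ^ 2 / h ^ 2 := ⟨_, rfl⟩
  have hL0 : 0 ≤ L := by
    have : (0 : ℝ) ≤ Real.log ((N + 1 : ℕ) : ℝ) :=
      Real.log_nonneg (by exact_mod_cast Nat.succ_le_succ (Nat.zero_le N))
    rw [hL]; positivity
  have hA0 : 0 ≤ A := (hψ N 0).trans (hA 0)
  refine ⟨fun y => ∑ s ∈ hfin.toFinset, ∑ pp ∈ contactPairs (Torus.geometry (Fin 3)) (hsDiameter σ N) (Φ.flow s z),
      (A * (M + L) + A * (2 * (h ^ 2)⁻¹) * (‖y.1‖ ^ 2 + ‖y.2.1‖ ^ 2 + ‖y.2.2.1‖ ^ 2 + ‖y.2.2.2‖ ^ 2)) *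
        gauss4 h (quadOf N (Φ.flow s z) pp.1 pp.2) y, ?_, fun x y => ?_⟩
  · exact integrable_finsetSum _ fun s _ => integrable_finsetSum _ fun pp _ => integrable_qn_mul_gauss4 hh.ne' _ _ _
  · set qn : ℝ := ‖y.1‖ ^ 2 + ‖y.2.1‖ ^ 2 + ‖y.2.2.1‖ ^ 2 + ‖y.2.2.2‖ ^ 2 with hqn
    have hgy0 : 0 ≤ ∑ s ∈ hfin.toFinset, ∑ pp ∈ contactPairs (Torus.geometry (Fin 3)) (hsDiameter σ N) (Φ.flow s z),
        (A * (M + L) + A * (2 * (h ^ 2)⁻¹) * qn) * gauss4 h (quadOf N (Φ.flow s z) pp.1 pp.2) y :=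
      Finset.sum_nonneg fun s _ => Finset.sum_nonneg fun pp _ => mul_nonneg (by positivity) (gauss4_nonneg h _ y)
    by_cases hZ : 0 < pairZ N ψ w x
    · rcases (DVTransfer.contactMass_nonneg hψ Φ γc t z k x hfin).eq_or_lt with hn0 | hn
      · -- empty window
        rw [DVTransfer.contactDens_eq_zero_of_contactMass_eq_zero hψ Φ γc h t z k x hfin hn0.symm y, zero_mul,
          norm_zero]
        exact hgy0
      · have hp := contactDens_pos hψ hh.ne' Φ γc t z k x hfin hn y
        have hq := DVTransfer.chaosDens_pos hψ hh.ne' N w x hZ y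
        have h1 := hM x y hn
        have h2 := abs_log_chaosDens_le_unif hψ hh.ne' w hV x hZ y
        rw [← hL] at h2
        have hpA := contactDens_le_sum hA Φ γc h t z k x hfin y
        rw [Real.log_div hp.ne' (mul_ne_zero hn.ne' hq.ne'), Real.log_mul hn.ne' hq.ne', Real.norm_eq_abs, abs_mul,
          abs_of_pos hp]
        have h3 : |Real.log (contactDens σ N Φ ψ γc h t z k x y) -
            (Real.log (contactMass σ N Φ ψ γc t z k x) + Real.log (chaosDens N ψ h w x y))| ≤
            (M + L) + 2 * (h ^ 2)⁻¹ * qn := by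
          calc |Real.log (contactDens σ N Φ ψ γc h t z k x y) -
                (Real.log (contactMass σ N Φ ψ γc t z k x) + Real.log (chaosDens N ψ h w x y))|
              = |(Real.log (contactDens σ N Φ ψ γc h t z k x y) - Real.log (contactMass σ N Φ ψ γc t z k x)) -
                  Real.log (chaosDens N ψ h w x y)| := by ring_nf
            _ ≤ |Real.log (contactDens σ N Φ ψ γc h t z k x y) - Real.log (contactMass σ N Φ ψ γc t z k x)| +
                  |Real.log (chaosDens N ψ h w x y)| := abs_sub _ _
            _ ≤ (M + qn / h ^ 2) + (L + qn / h ^ 2) := add_le_add h1 h2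
            _ = (M + L) + 2 * (h ^ 2)⁻¹ * qn := by rw [div_eq_mul_inv]; ring
        have hC0 : 0 ≤ (M + L) + 2 * (h ^ 2)⁻¹ * qn := by positivity
        calc contactDens σ N Φ ψ γc h t z k x y * |Real.log (contactDens σ N Φ ψ γc h t z k x y) -
              (Real.log (contactMass σ N Φ ψ γc t z k x) + Real.log (chaosDens N ψ h w x y))|
            ≤ (∑ s ∈ hfin.toFinset, ∑ pp ∈ contactPairs (Torus.geometry (Fin 3)) (hsDiameter σ N) (Φ.flow s z),
                A * gauss4 h (quadOf N (Φ.flow s z) pp.1 pp.2) y) * ((M + L) + 2 * (h ^ 2)⁻¹ * qn) :=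
              mul_le_mul hpA h3 (abs_nonneg _) (hp.le.trans hpA)
          _ = _ := by
              rw [Finset.sum_mul]
              refine Finset.sum_congr rfl fun s _ => ?_
              rw [Finset.sum_mul]
              refine Finset.sum_congr rfl fun pp _ => ?_
              ring
    · -- junk cell-window
      have hZ0 : pairZ N ψ w x = 0 := le_antisymm (not_lt.1 hZ) (DVTransfer.pairZ_nonneg hψ N w x)
      rw [DVTransfer.chaosDens_eq_zero_of_pairZ_eq_zero ψ h w x hZ0 y, mul_zero, div_zero, Real.log_zero, mul_zero,
        norm_zero]
      exact hgy0

/-- **Majorant of the tilted chaos reference**: for a nonnegative kernel family, `0 < h`, `0 < δ ≤ 1` and any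
configuration `w`, there is an integrable `g` on `Quad` with `e^{ΔΛ_x(y)/2} chaosDens_x(y) ≤ g(y)` for EVERY
location `x` (the junk cell-windows contribute `0`). -/
theorem exists_majorant_tilt (hψ : ∀ N y, 0 ≤ ψ N y) {h : ℝ} (hh : 0 < h) {δ : ℝ} (hδ0 : 0 < δ) (hδ1 : δ ≤ 1)
    (w : Cfg N) :
    ∃ g : Quad → ℝ, Integrable g ∧ ∀ (x : T3) (y : Quad),
      ‖Real.exp (2⁻¹ * dLam N ψ h δ w x y) * chaosDens N ψ h w x y‖ ≤ g y := by
  have hh2 : 0 < h ^ 2 := by positivity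
  have hV := norm_vel_le_sum w
  obtain ⟨V, hVdef⟩ : ∃ V : ℝ, V = ∑ j, ‖(w j).2‖ := ⟨_, rfl⟩
  rw [← hVdef] at hV
  obtain ⟨C, hC0, hC⟩ := exists_exp_half_dLam_le hψ hh hδ0 hδ1 w hV
  have g0 : 0 ≤ gauss h (0 : V3) 0 := DVTransfer.gauss_nonneg h 0 0
  -- `x`-free one-velocity majorants, two-fold smeared pair terms and pair fluxes
  obtain ⟨F, hF⟩ : ∃ F : Fin (N + 1) → V3 → ℝ, ∀ l v, F l v =
      Real.exp (3 * (V ^ 2 / h ^ 2)) * gauss h (0 : V3) 0 * Real.exp (-(‖v - (w l).2‖ ^ 2 / (8 * h ^ 2))) :=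
    ⟨_, fun _ _ => rfl⟩
  obtain ⟨S, hS⟩ : ∃ S : Fin (N + 1) → Fin (N + 1) → V3 × V3 → ℝ, ∀ l l' r, S l l' r =
      ∫ ω, hardSphereKernel ((w l).2, (w l').2) ω * (gauss h (collide ω ((w l).2, (w l').2)).1 r.1 *
        gauss h (collide ω ((w l).2, (w l').2)).2 r.2) ∂sphereMeasure := ⟨_, fun _ _ _ => rfl⟩
  obtain ⟨Bf, hBf⟩ : ∃ Bf : Fin (N + 1) → Fin (N + 1) → ℝ, ∀ l l', Bf l l' =
      ∫ ω, hardSphereKernel ((w l).2, (w l').2) ω ∂sphereMeasure := ⟨_, fun _ _ => rfl⟩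
  have hFi : ∀ l, Integrable (F l) := fun l => by
    have e : F l = fun v => Real.exp (3 * (V ^ 2 / h ^ 2)) * gauss h (0 : V3) 0 *
        Real.exp (-(‖v - (w l).2‖ ^ 2 / (8 * h ^ 2))) := funext fun v => hF l v
    rw [e]
    exact (DVTransfer.integrable_exp_neg_normSq_div (by positivity : (0 : ℝ) < 8 * h ^ 2) (w l).2).const_mul _
  have hSi : ∀ l l', Integrable (S l l') ((volume : Measure V3).prod volume) := fun l l' => by
    have e : S l l' = fun r => ∫ ω, hardSphereKernel ((w l).2, (w l').2) ω *
        (gauss h (collide ω ((w l).2, (w l').2)).1 r.1 * gauss h (collide ω ((w l).2, (w l').2)).2 r.2) ∂sphereMeasure :=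
      funext fun r => hS l l' r
    rw [e]
    exact DVTransfer.integrable_pairSmear2 hh.ne' ((w l).2, (w l').2)
  have hS0 : ∀ l l' r, 0 ≤ S l l' r := fun l l' r => by rw [hS]; exact DVTransfer.pairSmear2_nonneg h _ r
  have hF0 : ∀ l v, 0 ≤ F l v := fun l v => by
    rw [hF]; exact mul_nonneg (mul_nonneg (Real.exp_nonneg _) g0) (Real.exp_nonneg _)
  have hBf0 : ∀ l l', 0 ≤ Bf l l' := fun l l' => by
    rw [hBf]; exact DVTransfer.integral_hardSphereKernel_sphere_nonneg _
  refine ⟨fun y => C * ∑ l, ∑ l', F l y.1 * (F l' y.2.1 * ((Bf l l')⁻¹ * S l l' y.2.2)), ?_, fun x y => ?_⟩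
  · refine Integrable.const_mul ?_ _
    refine integrable_finsetSum _ fun l _ => integrable_finsetSum _ fun l' _ => ?_
    exact (hFi l).mul_prod ((hFi l').mul_prod ((hSi l l').const_mul _))
  · have hgy0 : 0 ≤ C * ∑ l, ∑ l', F l y.1 * (F l' y.2.1 * ((Bf l l')⁻¹ * S l l' y.2.2)) :=
      mul_nonneg hC0 (Finset.sum_nonneg fun l _ => Finset.sum_nonneg fun l' _ =>
        mul_nonneg (hF0 _ _) (mul_nonneg (hF0 _ _) (mul_nonneg (inv_nonneg.2 (hBf0 l l')) (hS0 _ _ _))))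
    by_cases hZ : 0 < pairZ N ψ w x
    · have hq : 0 ≤ chaosDens N ψ h w x y := DVTransfer.chaosDens_nonneg hψ hh.ne' N w x y
      rw [Real.norm_eq_abs, abs_of_nonneg (mul_nonneg (Real.exp_nonneg _) hq)]
      have htilt := hC x y
      obtain ⟨α, hα⟩ : ∃ α : ℝ, α = (4 * (cT N ψ w x + h ^ 2))⁻¹ := ⟨_, rfl⟩
      obtain ⟨u, hu⟩ : ∃ u : V3, u = cU N ψ w x := ⟨_, rfl⟩
      rw [← hα, ← hu] at htilt
      have hτ : 0 < cT N ψ w x + h ^ 2 := EntropyBudget.theta_pos w x (hψ N) hh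
      have hα0 : 0 ≤ α := by rw [hα]; positivity
      have hα4 : α ≤ (4 * h ^ 2)⁻¹ := by
        rw [hα]
        exact inv_anti₀ (by positivity) (mul_le_mul_of_nonneg_left (EntropyBudget.h2_le_theta w x (hψ N))
          (by norm_num))
      have step1 : Real.exp (2⁻¹ * dLam N ψ h δ w x y) * chaosDens N ψ h w x y ≤
          C * Real.exp (α * ‖y.1 - u‖ ^ 2) * Real.exp (α * ‖y.2.1 - u‖ ^ 2) * chaosDens N ψ h w x y :=
        mul_le_mul_of_nonneg_right htilt hq
      refine step1.trans ?_
      rw [DVTransfer.chaosDens_eq_sum_pairSmear2 ψ h w x y]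
      -- distribute the tilting factors and the normalisation into the double sum
      have e2 : C * Real.exp (α * ‖y.1 - u‖ ^ 2) * Real.exp (α * ‖y.2.1 - u‖ ^ 2) *
          ((pairZ N ψ w x)⁻¹ * ∑ l, ∑ l', cw N ψ w x l * cw N ψ w x l' *
            (gauss h (w l).2 y.1 * gauss h (w l').2 y.2.1 *
              ∫ ω, hardSphereKernel ((w l).2, (w l').2) ω * (gauss h (collide ω ((w l).2, (w l').2)).1 y.2.2.1 *
                gauss h (collide ω ((w l).2, (w l').2)).2 y.2.2.2) ∂sphereMeasure)) =
          C * ∑ l, ∑ l', (Real.exp (α * ‖y.1 - u‖ ^ 2) * gauss h (w l).2 y.1) *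
            ((Real.exp (α * ‖y.2.1 - u‖ ^ 2) * gauss h (w l').2 y.2.1) *
              ((pairZ N ψ w x)⁻¹ * (cw N ψ w x l * cw N ψ w x l') * S l l' y.2.2)) := by
        simp only [Finset.mul_sum, hS]
        refine Finset.sum_congr rfl fun l _ => Finset.sum_congr rfl fun l' _ => ?_
        ring
      rw [e2]
      refine mul_le_mul_of_nonneg_left (Finset.sum_le_sum fun l _ => Finset.sum_le_sum fun l' _ => ?_) hC0
      -- termwise comparison
      have hexpV : ∀ i : Fin (N + 1), Real.exp (3 * α * ‖(w i).2 - u‖ ^ 2) ≤ Real.exp (3 * (V ^ 2 / h ^ 2)) := by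
        intro i
        refine Real.exp_le_exp.2 ?_
        have hvu : ‖(w i).2 - u‖ ≤ 2 * V := by rw [hu]; exact EntropyBudget.norm_vel_sub_cU_le w x (hψ N) hV i
        have hvu2 : ‖(w i).2 - u‖ ^ 2 ≤ (2 * V) ^ 2 := pow_le_pow_left₀ (norm_nonneg _) hvu 2
        calc 3 * α * ‖(w i).2 - u‖ ^ 2 ≤ 3 * (4 * h ^ 2)⁻¹ * (2 * V) ^ 2 :=
              mul_le_mul (mul_le_mul_of_nonneg_left hα4 (by norm_num)) hvu2 (sq_nonneg _) (by positivity)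
          _ = 3 * (V ^ 2 / h ^ 2) := by field_simp; ring
      have hb : ∀ (i : Fin (N + 1)) (v : V3), Real.exp (α * ‖v - u‖ ^ 2) * gauss h (w i).2 v ≤ F i v := by
        intro i v
        refine (DVTransfer.exp_quad_mul_gauss_le hh.ne' hα0 hα4 u _ _).trans ?_
        rw [hF]
        exact mul_le_mul_of_nonneg_right (mul_le_mul_of_nonneg_right (hexpV i) g0) (Real.exp_nonneg _)
      have n1 : 0 ≤ Real.exp (α * ‖y.1 - u‖ ^ 2) * gauss h (w l).2 y.1 :=
        mul_nonneg (Real.exp_nonneg _) (DVTransfer.gauss_nonneg h _ _)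
      have n2 : 0 ≤ Real.exp (α * ‖y.2.1 - u‖ ^ 2) * gauss h (w l').2 y.2.1 :=
        mul_nonneg (Real.exp_nonneg _) (DVTransfer.gauss_nonneg h _ _)
      have b3 : (pairZ N ψ w x)⁻¹ * (cw N ψ w x l * cw N ψ w x l') * S l l' y.2.2 ≤ (Bf l l')⁻¹ * S l l' y.2.2 := by
        rw [hS, hBf]; exact coeff_mul_pairSmear2_le hψ h w x l l' y.2.2
      have n3 : 0 ≤ (pairZ N ψ w x)⁻¹ * (cw N ψ w x l * cw N ψ w x l') * S l l' y.2.2 :=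
        mul_nonneg (mul_nonneg (inv_nonneg.2 (DVTransfer.pairZ_nonneg hψ N w x))
          (mul_nonneg (DVTransfer.cw_nonneg hψ N w x l) (DVTransfer.cw_nonneg hψ N w x l'))) (hS0 _ _ _)
      exact mul_le_mul (hb l y.1) (mul_le_mul (hb l' y.2.1) b3 n3 (hF0 _ _)) (mul_nonneg n2 n3) (hF0 _ _)
    · -- junk cell-window
      have hZ0 : pairZ N ψ w x = 0 := le_antisymm (not_lt.1 hZ) (DVTransfer.pairZ_nonneg hψ N w x)
      rw [DVTransfer.chaosDens_eq_zero_of_pairZ_eq_zero ψ h w x hZ0 y, mul_zero, norm_zero]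
      exact hgy0

/-! ## The three integrabilities on the torus -/

/-- **`x`-integrability of the three summands of G2.** For an admissible kernel family, `0 < h`, `0 < δ ≤ 1`, a
hard-sphere flow, a good initial datum and a window `k`, the functions `x ↦ cellOK · crossE`, `x ↦ klTerm`,
`x ↦ cellOK · dvAct` are integrable on `𝕋³` (jointly Borel integrands dominated by integrable functions of the
quadruple alone, on the finite measure space `𝕋³ × Quad`; bounded Borel factors `cellOK`, `contactMass`). -/
theorem xIntegrable {γc C' : ℝ} (hadm : AdmissibleKernel γc C' ψ) {h : ℝ} (hh : 0 < h) {δ : ℝ} (hδ0 : 0 < δ)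
    (hδ1 : δ ≤ 1) (Φ : Flow σ N) (t : ℝ) {z : Cfg N} (hz : z ∈ Φ.good) (k : ℕ) :
    Integrable (fun x : T3 => cellOK σ N Φ ψ γc z k x * crossE σ N Φ ψ γc h δ t z k x) ∧
    Integrable (fun x : T3 => klTerm σ N Φ ψ γc h t z k x) ∧
    Integrable (fun x : T3 => cellOK σ N Φ ψ γc z k x * dvAct σ N Φ ψ γc h δ t z k x) := by
  have hψ : ∀ N y, 0 ≤ ψ N y := hadm.2.1
  have hψc : Continuous (ψ N) := (hadm.1 N).continuous
  have hA : ∀ y, ψ N y ≤ C' * ((N : ℝ) + 1) ^ (3 * γc) := hadm.2.2.2.2.1 N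
  have hfin := DVTransfer.finite_collisionTimes_win Φ hz γc t k
  -- (1) the tilted chaos reference
  obtain ⟨g₁, hg₁, hb₁⟩ := exists_majorant_tilt hψ hh hδ0 hδ1 (Φ.flow ((k : ℝ) * winW γc N) z)
  have I₁ : Integrable fun x : T3 => ∫ y, Real.exp (2⁻¹ * dLam N ψ h δ (Φ.flow ((k : ℝ) * winW γc N) z) x y) *
      chaosDens N ψ h (Φ.flow ((k : ℝ) * winW γc N) z) x y :=
    integrable_parametric (F := fun p : T3 × Quad => Real.exp (2⁻¹ * dLam N ψ h δ (Φ.flow ((k : ℝ) * winW γc N) z)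
      p.1 p.2) * chaosDens N ψ h (Φ.flow ((k : ℝ) * winW γc N) z) p.1 p.2)
      (measurable_tiltIntegrand hψc h δ _) hg₁ (fun p => hb₁ p.1 p.2)
  -- (2) the relative entropy
  obtain ⟨g₂, hg₂, hb₂⟩ := exists_majorant_kl hψ hA hh Φ γc t hz k (Φ.flow ((k : ℝ) * winW γc N) z)
  have I₂ : Integrable fun x : T3 => ∫ y, contactDens σ N Φ ψ γc h t z k x y *
      Real.log (contactDens σ N Φ ψ γc h t z k x y /
        (contactMass σ N Φ ψ γc t z k x * chaosDens N ψ h (Φ.flow ((k : ℝ) * winW γc N) z) x y)) :=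
    integrable_parametric (F := fun p : T3 × Quad => contactDens σ N Φ ψ γc h t z k p.1 p.2 *
      Real.log (contactDens σ N Φ ψ γc h t z k p.1 p.2 /
        (contactMass σ N Φ ψ γc t z k p.1 * chaosDens N ψ h (Φ.flow ((k : ℝ) * winW γc N) z) p.1 p.2)))
      (measurable_klIntegrand hψc Φ γc h t z k hfin _) hg₂ (fun p => hb₂ p.1 p.2)
  -- (3) the DV action
  obtain ⟨g₃, hg₃, hb₃⟩ := exists_majorant_dvAct hψ hA hh hδ0 hδ1 Φ γc t hz k (Φ.flow ((k : ℝ) * winW γc N) z)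
  have I₃ : Integrable fun x : T3 => ∫ y, 2⁻¹ * dLam N ψ h δ (Φ.flow ((k : ℝ) * winW γc N) z) x y *
      contactDens σ N Φ ψ γc h t z k x y :=
    integrable_parametric (F := fun p : T3 × Quad => 2⁻¹ * dLam N ψ h δ (Φ.flow ((k : ℝ) * winW γc N) z) p.1 p.2 *
      contactDens σ N Φ ψ γc h t z k p.1 p.2)
      (measurable_dvActIntegrand hψc Φ γc h δ t z k hfin _) hg₃ (fun p => hb₃ p.1 p.2)
  -- bounded Borel factors
  have hOK := measurable_cellOK hψc Φ γc z k
  have hOKb := norm_cellOK_le Φ ψ γc z k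
  have hnM := (continuous_contactMass hψc Φ γc t z k hfin).measurable
  have hMn : ∀ x, ‖contactMass σ N Φ ψ γc t z k x‖ ≤ ∑ s ∈ hfin.toFinset,
      ∑ _p ∈ contactPairs (Torus.geometry (Fin 3)) (hsDiameter σ N) (Φ.flow s z), C' * ((N : ℝ) + 1) ^ (3 * γc) :=
    fun x => by
      rw [Real.norm_eq_abs, abs_of_nonneg (DVTransfer.contactMass_nonneg hψ Φ γc t z k x hfin)]
      exact contactMass_le Φ hA γc t z k hfin x
  unfold crossE klTerm dvAct
  refine ⟨?_, I₂, ?_⟩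
  · exact integrable_bdd_mul (integrable_bdd_mul ((integrable_const 1).sub I₁) hnM hMn) hOK hOKb
  · exact integrable_bdd_mul I₃.neg hOK hOKb

end DVAggregate

/-! ## The registered stub -/

/-- **S2″ — THE AGGREGATE DV STEP (G2).** For nice profiles, `0 < σ < 1/2`, an admissible cell family at
`γc ∈ (1/6, 1/3)`, every flow family, `t > 0` (H2 and few collisions are not needed) and `(h, δ) ∈ (0,1)²`:
`DVAggregateOn` — `∀ η > 0, P_N{dvActW + η(N+1)^{1/3} < crossEW − relEnt} → 0`. On the good set (conull for
`localGibbsLaw`) the S2 worker's pointwise DV inequality `cellOK·crossE − klTerm ≤ cellOK·dvAct` integrates in `x`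
and sums over `k < nWin` to `crossEW − relEnt ≤ dvActW` (`DVTransfer.dvAggregateOn_of_xIntegrable`), the three
summands being integrable on `𝕋³` by `DVAggregate.xIntegrable`; the bad events are empty for every `N`. -/
theorem stub_dvAggregate : ∀ (a₀ θ₀ : T3 → ℝ) (u₀ : T3 → V3), NiceProfiles a₀ θ₀ u₀ → ∀ σ : ℝ, 0 < σ → σ < 2⁻¹ → ∀ (γc C' : ℝ) (ψ : ℕ → T3 → ℝ), 1 / 6 < γc → γc < 1 / 3 → AdmissibleKernel γc C' ψ → ∀ (Φ : Flows σ) (t : ℝ), 0 < t → TailsOn σ a₀ θ₀ u₀ Φ t → FewCollisionsOn σ a₀ θ₀ u₀ Φ t → ∀ h δ : ℝ, 0 < h → h < 1 → 0 < δ → δ < 1 → DVAggregateOn σ a₀ θ₀ u₀ Φ ψ γc h δ t := by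
  intro a₀ θ₀ u₀ _ σ _ _ γc C' ψ _ _ hadm Φ t _ _ _ h δ hh _ hδ0 hδ1
  exact DVTransfer.dvAggregateOn_of_xIntegrable hadm.2.1 hh.ne' hδ0 hδ1.le Φ γc t fun N =>
    Eventually.of_forall fun z hz k _ => DVAggregate.xIntegrable hadm hh hδ0 hδ1.le (Φ N) t hz k

end

end Summit.AtomisticToContinuum.HydrodynamicLimit.Theorems.BlockHDissipation
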